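import Literature.MathematicalPhysics.QuantumFieldTheory.QuasiLocalGaugePerturbationKernels
import Literature.Probability.LatticeModels.CoarseCellFiniteSize
import HarnessLib

/-!
# Quasi-local gauge-invariant perturbations, VI: the DLR kernels read through coarse cells

Sixth file on the tree's `QuasiLocalGaugePerturbation d N G b`. The DLR kernels of the perturbed
torus measure `μ_{β,W}` (`QuasiLocalGaugePerturbation.kernel`: glued product Haar tilted by
`-β S_W - W`, the specification of `…Kernels.lean`) are read through an ARBITRARY labelling
`cell : Edge d N → CoarseIdx μc` of the links by the cells of a coarse torus (vocabulary of
`CoarseCellFiniteSize.lean`, Dobrushin–Shlosman finite-size conditions) subject to two geometric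
hypotheses — every cell meets at most `K` blocks (`|blockCorner(A)| ≤ K · cellCount A`), and cells
CONTRACT block nearness (links whose blocks are `(2D+1)`-near lie in cells at coarse distance
`≤ D + 1`); both hold for products of cyclic frames of scale `b' ∈ [2b, 4b]` with `K = 10^d`
(`BlockCellGeometry.lean`). Output:

* `isLocallyAC_kernel_of_card_le` — `‖W‖_{b,κ} ≤ η` (`κ ≥ 0`) makes the kernels of `W` LOCALLY
  ABSOLUTELY CONTINUOUS w.r.t. Wilson's (`W = 0`) at rate `2 K η` per cell (two-sided density
  continuity in `W`, `…Kernels`);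
* `hasLeak_kernel_of_card_le` — under range control the kernels at window `n` have the LEAK PROFILE
  `(exp(4 η K (4n+1)^d) - 1) e^{-κ D}` (quasi-locality in the exterior, `…Kernels`, with `m = 2D`
  blocks; a window of cell-radius `2n` has `≤ (4n+1)^d` cells, `cellCount_le_pow_of_cdist_le`);
  Wilson's kernels do not leak (`hasLeak_kernel_zero`).

Sources: Georgii, *Gibbs Measures and Phase Transitions* (2011), Ch. 8 (bounded perturbations of
specifications); Dobrushin–Shlosman (1985), §2; Bałaban, CMP 119 (1988) p. 259–261 (format of `W`).
Folklore-level corollaries of `…Kernels`.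
-/

noncomputable section

open MeasureTheory
open Literature.Probability.LatticeModels (CoarseIdx cdist cellCount IsLocallyAC HasLeak glueWith
  Specification IsSpecification cdist_self)
open Literature.MathematicalPhysics.QuantumLattice

namespace Literature.MathematicalPhysics.QuantumFieldTheory

/-! ### Cube counting on the coarse torus -/

section Counting

variable {d : ℕ} {μc : Fin d → ℕ}

/-- A finite set of sites / links inside the cells within coarse distance `K` of `c` meets at most
`(2K+1)^d` cells: the cube of cell-radius `K` has at most `(2K+1)^d` cells (inject
`c' ↦ (valMinAbs (cᵢ - c'ᵢ))ᵢ` into `[-K, K]^d`; the same count as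
`CoarseCellMixingCounting.card_filter_cdist_le`, not imported so that this file's cone stays
`…Kernels` + `CoarseCellFiniteSize`). [cite: DobrushinShlosman1985, §2] -/
theorem cellCount_le_pow_of_cdist_le {V : Type*} [Fintype V] (cell : V → CoarseIdx μc)
    (c : CoarseIdx μc) (K : ℕ) (A : Finset V) (hA : ∀ v ∈ A, cdist c (cell v) ≤ K) :
    cellCount cell A ≤ (2 * K + 1) ^ d := by
  classical
  -- the cube count
  have hcube : (Finset.univ.filter fun c' : CoarseIdx μc => cdist c c' ≤ K).card ≤
      (2 * K + 1) ^ d := by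
    set S₁ : (i : Fin d) → Finset (ZMod (μc i + 1)) := fun i =>
      Finset.univ.filter fun z => ((c i - z).valMinAbs).natAbs ≤ K
    have hsub : (Finset.univ.filter fun c' : CoarseIdx μc => cdist c c' ≤ K) ⊆
        Fintype.piFinset S₁ := by
      intro c' hc'
      rw [Finset.mem_filter] at hc'
      exact Fintype.mem_piFinset.2 fun i => Finset.mem_filter.2 ⟨Finset.mem_univ _,
        (Finset.le_sup (f := fun i : Fin d => ((c i - c' i).valMinAbs).natAbs)
          (Finset.mem_univ i)).trans hc'.2⟩
    refine (Finset.card_le_card hsub).trans ?_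
    rw [Fintype.card_piFinset]
    have h1 : ∀ i, (S₁ i).card ≤ 2 * K + 1 := fun i => by
      have hinj : Set.InjOn (fun z : ZMod (μc i + 1) => (c i - z).valMinAbs) ↑(S₁ i) :=
        fun z _ z' _ h => sub_right_injective (ZMod.valMinAbs_inj.1 h)
      have hmaps : ∀ z ∈ S₁ i, (c i - z).valMinAbs ∈ Finset.Icc (-(K : ℤ)) K :=
        fun z hz => by
          have hz' := (Finset.mem_filter.1 hz).2
          rw [Finset.mem_Icc]
          rcases Int.natAbs_eq (c i - z).valMinAbs with h | h <;> constructor <;> omega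
      calc (S₁ i).card ≤ (Finset.Icc (-(K : ℤ)) K).card :=
            Finset.card_le_card_of_injOn _ hmaps hinj
        _ = 2 * K + 1 := by rw [Int.card_Icc]; omega
    calc ∏ i, (S₁ i).card ≤ ∏ _i : Fin d, (2 * K + 1) :=
          Finset.prod_le_prod (fun _ _ => Nat.zero_le _) fun i _ => h1 i
      _ = (2 * K + 1) ^ d := by simp
  unfold cellCount
  refine (Finset.card_le_card fun c' hc' => ?_).trans hcube
  obtain ⟨-, v, hv, rfl⟩ := Finset.mem_filter.1 hc'
  exact Finset.mem_filter.2 ⟨Finset.mem_univ _, hA v hv⟩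

end Counting

/-! ### The DLR kernels of `μ_{β,W}` through cells -/

section Kernels

namespace QuasiLocalGaugePerturbation

variable {G : Type*} [Group G] [TopologicalSpace G] [IsTopologicalGroup G] [CompactSpace G]
  [MeasurableSpace G] [BorelSpace G] {Nρ : ℕ} (ρ : G →* Matrix (Fin Nρ) (Fin Nρ) ℂ) {d N : ℕ}
  [NeZero N] {b : ℕ} {μc : Fin d → ℕ}

/-- **The DLR kernels of the perturbed torus measure** `μ_{β,W}`: product Haar on the links of `Λ`
glued with the exterior `ζ`, tilted by the full action `-β S_W - W` (Georgii 2011, Def. 1.23 and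
Rem. 1.24; the specification of `…Kernels`). [cite: Georgii2011, Def. 1.23] -/
def kernel (β : ℝ) (W : QuasiLocalGaugePerturbation d N G b) : Specification (Edge d N) G :=
  fun Λ ζ => ((Measure.pi fun _ : ↥Λ => haarProbability G).map (glueWith Λ · ζ)).tilted
    fun U => -β * wilsonAction ρ U - W.total U

/-- Wilson's kernels (`W = 0`) do not depend on the block scale carried by `0`. [folklore] -/
theorem kernel_zero_eq (β : ℝ) (b₁ b₂ : ℕ) :
    (0 : QuasiLocalGaugePerturbation d N G b₁).kernel ρ β =
      (0 : QuasiLocalGaugePerturbation d N G b₂).kernel ρ β := by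
  unfold kernel
  simp only [total_zero]

/-- Convexity of the exponential: `e^{ts} - 1 ≤ t (e^s - 1)` for `t ∈ [0, 1]`. [folklore] -/
theorem exp_mul_sub_one_le_mul {s t : ℝ} (ht0 : 0 ≤ t) (ht1 : t ≤ 1) :
    Real.exp (t * s) - 1 ≤ t * (Real.exp s - 1) := by
  have h := convexOn_exp.2 (Set.mem_univ 0) (Set.mem_univ s) (by linarith : 0 ≤ 1 - t) ht0
    (by ring)
  simp only [smul_eq_mul, mul_zero, zero_add, Real.exp_zero, mul_one] at h
  linarith

/-- A `[0,1]`-valued function has integral at most `1` under a probability measure. [folklore] -/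
theorem integral_le_one_of_forall_le_one {α : Type*} [MeasurableSpace α] (ν : Measure α)
    [IsProbabilityMeasure ν] {f : α → ℝ} (hf01 : ∀ σ, 0 ≤ f σ ∧ f σ ≤ 1) :
    ∫ σ, f σ ∂ν ≤ 1 := by
  have h := norm_integral_le_of_norm_le_const (μ := ν) (f := f) (C := 1)
    (Filter.Eventually.of_forall fun σ => by
      rw [Real.norm_eq_abs, abs_le]; exact ⟨by linarith [(hf01 σ).1], (hf01 σ).2⟩)
  simp only [Real.norm_eq_abs, probReal_univ, mul_one] at h
  exact (le_abs_self _).trans h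

variable [SecondCountableTopology G] (hρ : Continuous ρ)
include hρ

/-- **Local absolute continuity of the perturbed kernels w.r.t. Wilson's, through cells**: if every
cell meets at most `K` blocks, `‖W‖_{b,κ} ≤ η` (`κ ≥ 0`) gives `IsLocallyAC` at every rate
`ε₁ ≥ 2 K η` per cell (two-sided density continuity in `W`). [cite: Georgii2011, Ch. 8] -/
theorem isLocallyAC_kernel_of_card_le (cell : Edge d N → CoarseIdx μc) {K : ℝ}
    (hK : ∀ A : Finset (Edge d N),
      ((A.image fun e => blockCorner b e.1).card : ℝ) ≤ K * cellCount cell A)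
    (β : ℝ) {κ η ε₁ : ℝ} (hκ : 0 ≤ κ) (hη : 0 ≤ η) (hε : 2 * η * K ≤ ε₁)
    (W : QuasiLocalGaugePerturbation d N G b) (hW : W.NormLE κ η) :
    IsLocallyAC cell (W.kernel ρ β) ((0 : QuasiLocalGaugePerturbation d N G 1).kernel ρ β) ε₁ := by
  rw [kernel_zero_eq ρ β 1 b]
  intro A hA ζ f hf hf01
  set R := A.image fun e => blockCorner b e.1 with hRdef
  have hR : R ⊆ blockCorners b := fun y hy => by
    obtain ⟨e, -, rfl⟩ := Finset.mem_image.1 hy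
    exact mem_blockCorners_iff.2 (isBlockAligned_blockCorner b e.1)
  have hΛ : ∀ e ∈ A, blockCorner b e.1 ∈ R := fun e he => Finset.mem_image_of_mem _ he
  have hnorm : (W - 0).NormLE κ η :=
    (hW.sub (normLE_zero le_rfl)).mono (le_of_eq (add_zero η))
  obtain ⟨h1, h2'⟩ :=
    integral_kernel_le_exp_mul_of_normLE_sub ρ hρ β W 0 hκ hnorm hR hΛ ζ hf hf01
  have hexp : Real.exp (2 * η * R.card) ≤ Real.exp (ε₁ * cellCount cell A) := by
    refine Real.exp_le_exp.2 ?_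
    have hc : (R.card : ℝ) ≤ K * (cellCount cell A : ℝ) := hK A
    calc 2 * η * R.card ≤ 2 * η * (K * (cellCount cell A : ℝ)) :=
          mul_le_mul_of_nonneg_left hc (by positivity)
      _ = (2 * η * K) * cellCount cell A := by ring
      _ ≤ ε₁ * cellCount cell A := mul_le_mul_of_nonneg_right hε (Nat.cast_nonneg _)
  exact ⟨h1.trans (mul_le_mul_of_nonneg_right hexp (integral_nonneg fun U => (hf01 U).1)),
    h2'.trans (mul_le_mul_of_nonneg_right hexp (integral_nonneg fun U => (hf01 U).1))⟩

/-- **The leak profile of the perturbed kernels, through cells**: if every cell meets at most `K`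
blocks and cells contract block nearness (links whose blocks are `(2D+1)`-near lie at coarse
distance `≤ D + 1`), then under `‖W‖_{b,κ} ≤ η` (`κ ≥ 0`), range control and `b ≥ 1` the kernels at
window `n` leak with amplitude `exp(4 η K (4n+1)^d) - 1` and rate `κ` (quasi-locality in the
exterior with `m = 2D` blocks; `e^{tX} - 1 ≤ t (e^X - 1)`). [cite: Georgii2011, Ch. 8] -/
theorem hasLeak_kernel_of_card_le [MeasurableSingletonClass G] (hb : 1 ≤ b)
    (cell : Edge d N → CoarseIdx μc) {K : ℝ} (hK0 : 0 ≤ K)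
    (hK : ∀ A : Finset (Edge d N),
      ((A.image fun e => blockCorner b e.1).card : ℝ) ≤ K * cellCount cell A)
    (hcon : ∀ (D : ℕ) (e e' : Edge d N),
      (∀ i, (blockCorner b e'.1 i - blockCorner b e.1 i).val ≤ b * (2 * D + 1) ∨
        (blockCorner b e.1 i - blockCorner b e'.1 i).val ≤ b * (2 * D + 1)) →
      cdist (cell e') (cell e) ≤ D + 1)
    (β : ℝ) {κ η : ℝ} (hκ : 0 ≤ κ) (n : ℕ) (W : QuasiLocalGaugePerturbation d N G b)
    (hW : W.NormLE κ η)
    (hRC : ∀ X : Finset (Site d N), X ∈ polymers b → (∃ U : GaugeConfig d N G, W.act X U ≠ 0) →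
      ∀ y ∈ X, ∀ y' ∈ X, ∀ i : Fin d, (y i - y' i).val ≤ b * X.card ∨ (y' i - y i).val ≤ b * X.card) :
    HasLeak cell (W.kernel ρ β) n (Real.exp (4 * η * (K * (4 * n + 1) ^ d)) - 1) κ := by
  intro c A hA hAc D ζ ζ' hζ f hf hf01 hdep
  have hη : 0 ≤ η := hW.nonneg
  have hsp : IsSpecification (W.kernel ρ β) :=
    (isSpecification_and_isGibbsMeasure_perturbedMeasure ρ hρ β W).1
  set R := A.image fun e => blockCorner b e.1 with hRdef
  have hR : R ⊆ blockCorners b := fun y hy => by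
    obtain ⟨e, -, rfl⟩ := Finset.mem_image.1 hy
    exact mem_blockCorners_iff.2 (isBlockAligned_blockCorner b e.1)
  have hΛ : ∀ e ∈ A, blockCorner b e.1 ∈ R := fun e he => Finset.mem_image_of_mem _ he
  -- triangle inequality on the coarse torus
  have htri : ∀ x y z : CoarseIdx μc, cdist x z ≤ cdist x y + cdist y z := fun x y z =>
    Finset.sup_le fun i _ => by
      have hxz : x i - z i = (x i - y i) + (y i - z i) := by abel
      rw [hxz]
      exact (ZMod.natAbs_valMinAbs_add_le _ _).trans ((Int.natAbs_add_le _ _).trans (add_le_add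
        (Finset.le_sup (f := fun i : Fin d => ((x i - y i).valMinAbs).natAbs) (Finset.mem_univ i))
        (Finset.le_sup (f := fun i : Fin d => ((y i - z i).valMinAbs).natAbs) (Finset.mem_univ i))))
  -- geometry: links (2D+1)-near the blocks of `A` lie in cells within `2n+1+D` of `c`
  have hgeo : ∀ e : Edge d N, (∃ y ∈ R, ∀ i, (y i - blockCorner b e.1 i).val ≤ b * (2 * D + 1) ∨
      (blockCorner b e.1 i - y i).val ≤ b * (2 * D + 1)) → cdist c (cell e) ≤ 2 * n + 1 + D := by
    rintro e ⟨y, hy, hnear⟩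
    obtain ⟨e', he', rfl⟩ := Finset.mem_image.1 hy
    calc cdist c (cell e) ≤ cdist c (cell e') + cdist (cell e') (cell e) := htri _ _ _
      _ ≤ 2 * n + (D + 1) := add_le_add (hA e' he') (hcon D e e' hnear)
      _ = 2 * n + 1 + D := by ring
  have hagree : ∀ e : Edge d N, (∃ y ∈ R, ∀ i, (y i - blockCorner b e.1 i).val ≤ b * (2 * D + 1) ∨
      (blockCorner b e.1 i - y i).val ≤ b * (2 * D + 1)) → ζ e = ζ' e :=
    fun e he => hζ e (hgeo e he)
  have hcc : ∀ e : Edge d N, cell e = c → cdist c (cell e) ≤ 2 * n + 1 + D :=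
    fun e he => by rw [he, cdist_self]; exact Nat.zero_le _
  have hdep1 : DependsOn f {e : Edge d N | e ∈ A ∨ ζ e = ζ' e} :=
    hdep.mono fun e he => Or.inr (hζ e (hcc e he))
  have hdep2 : DependsOn f {e : Edge d N | e ∈ A ∨ ζ' e = ζ e} :=
    hdep.mono fun e he => Or.inr (hζ e (hcc e he)).symm
  -- the amplitude
  set F := Real.exp (4 * (η * Real.exp (-(κ * ((2 * D : ℕ) : ℝ)))) * R.card) with hF
  haveI : IsProbabilityMeasure (W.kernel ρ β A ζ) := hsp.isProbability A ζ
  haveI : IsProbabilityMeasure (W.kernel ρ β A ζ') := hsp.isProbability A ζ'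
  set I := ∫ U, f U ∂(W.kernel ρ β A ζ) with hI
  set I' := ∫ U, f U ∂(W.kernel ρ β A ζ') with hI'
  have h12 : I ≤ F * I' :=
    integral_kernel_le_exp_mul_of_exterior_eq ρ hρ hb β W hκ hW hRC hR hΛ (2 * D) hagree hf hf01 hdep1
  have h21 : I' ≤ F * I :=
    integral_kernel_le_exp_mul_of_exterior_eq ρ hρ hb β W hκ hW hRC hR hΛ (2 * D)
      (fun e he => (hagree e he).symm) hf hf01 hdep2
  have hI0 : 0 ≤ I := integral_nonneg fun U => (hf01 U).1
  have hI'0 : 0 ≤ I' := integral_nonneg fun U => (hf01 U).1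
  have hI1 : I ≤ 1 := integral_le_one_of_forall_le_one _ hf01
  have hI'1 : I' ≤ 1 := integral_le_one_of_forall_le_one _ hf01
  have hF1 : 1 ≤ F := Real.one_le_exp (by positivity)
  have habs : |I - I'| ≤ F - 1 := by
    rw [abs_le]; constructor <;> nlinarith
  -- `F - 1 ≤ e^{-κ D} (exp X - 1)`
  set t := Real.exp (-(κ * ((2 * D : ℕ) : ℝ))) with ht
  have ht0 : 0 ≤ t := (Real.exp_pos _).le
  have ht1 : t ≤ 1 := Real.exp_le_one_iff.2 (by simp only [Left.neg_nonpos_iff]; positivity)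
  have htD : t ≤ Real.exp (-(κ * D)) := by
    refine Real.exp_le_exp.2 (neg_le_neg (mul_le_mul_of_nonneg_left ?_ hκ))
    exact_mod_cast (by omega : D ≤ 2 * D)
  have hcard : (R.card : ℝ) ≤ K * (4 * n + 1) ^ d := by
    have h2' : (cellCount cell A : ℝ) ≤ (4 * n + 1) ^ d := by
      have := cellCount_le_pow_of_cdist_le cell c (2 * n) A hA
      have h3 : 2 * (2 * n) + 1 = 4 * n + 1 := by ring
      rw [h3] at this
      exact_mod_cast this
    exact (hK A).trans (mul_le_mul_of_nonneg_left h2' hK0)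
  have hX : 4 * η * (R.card : ℝ) ≤ 4 * η * (K * (4 * n + 1) ^ d) :=
    mul_le_mul_of_nonneg_left hcard (by positivity)
  have hF' : F - 1 ≤ t * (Real.exp (4 * η * (K * (4 * n + 1) ^ d)) - 1) := by
    have hFt : F = Real.exp (t * (4 * η * R.card)) := by rw [hF]; ring_nf
    rw [hFt]
    refine (exp_mul_sub_one_le_mul ht0 ht1).trans (mul_le_mul_of_nonneg_left ?_ ht0)
    exact sub_le_sub_right (Real.exp_le_exp.2 hX) 1
  have hpos : 0 ≤ Real.exp (4 * η * (K * (4 * n + 1) ^ d)) - 1 :=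
    sub_nonneg.2 (Real.one_le_exp (by positivity))
  calc |I - I'| ≤ F - 1 := habs
    _ ≤ t * (Real.exp (4 * η * (K * (4 * n + 1) ^ d)) - 1) := hF'
    _ ≤ Real.exp (-(κ * D)) * (Real.exp (4 * η * (K * (4 * n + 1) ^ d)) - 1) :=
        mul_le_mul_of_nonneg_right htD hpos
    _ = (Real.exp (4 * η * (K * (4 * n + 1) ^ d)) - 1) * Real.exp (-(κ * D)) := mul_comm _ _

/-- **Wilson's kernels do not leak** beyond the window: `HasLeak` with every amplitude `Λl ≥ 0`
(the case `W = 0`, `η = 0`: the kernels are Markov at block scale, and cells contract block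
nearness). [folklore] -/
theorem hasLeak_kernel_zero [MeasurableSingletonClass G] (hb : 1 ≤ b)
    (cell : Edge d N → CoarseIdx μc) {K : ℝ} (hK0 : 0 ≤ K)
    (hK : ∀ A : Finset (Edge d N),
      ((A.image fun e => blockCorner b e.1).card : ℝ) ≤ K * cellCount cell A)
    (hcon : ∀ (D : ℕ) (e e' : Edge d N),
      (∀ i, (blockCorner b e'.1 i - blockCorner b e.1 i).val ≤ b * (2 * D + 1) ∨
        (blockCorner b e.1 i - blockCorner b e'.1 i).val ≤ b * (2 * D + 1)) →
      cdist (cell e') (cell e) ≤ D + 1)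
    (β : ℝ) {κ : ℝ} (hκ : 0 ≤ κ) (n : ℕ) {Λl : ℝ} (hΛl : 0 ≤ Λl) :
    HasLeak cell ((0 : QuasiLocalGaugePerturbation d N G 1).kernel ρ β) n Λl κ := by
  have h0 := hasLeak_kernel_of_card_le ρ hρ hb cell hK0 hK hcon β hκ n
    (0 : QuasiLocalGaugePerturbation d N G b) (normLE_zero le_rfl)
    (fun X _ hU => by obtain ⟨U, hU⟩ := hU; exact absurd (zero_act X U) hU)
  rw [kernel_zero_eq ρ β b 1] at h0
  simp only [MulZeroClass.mul_zero, MulZeroClass.zero_mul, Real.exp_zero, sub_self] at h0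
  exact fun c A hA hAc D ζ ζ' hζ f hf hf01 hdep => (h0 c A hA hAc D ζ ζ' hζ f hf hf01 hdep).trans
    (mul_le_mul_of_nonneg_right hΛl (Real.exp_pos _).le)

end QuasiLocalGaugePerturbation

end Kernels

end Literature.MathematicalPhysics.QuantumFieldTheory
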